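import Mathlib
import Summits.ResolutionOfSingularities.ResolutionOfSingularities.Theorems.WeightedInvariantLocalWeightedDropTOT2Near

/-!
# `WeightedInvariant.LocalWeightedDrop`, TOT₂ line (skeleton v32, residual `stub_spaceNCRankDrop`), piece S-NEAR part 2:
# (N2) THE DIRECTRIX DOES NOT GROW AT NEAR POINTS — `e_{x′} ≤ e_x` (hypersurface form, every characteristic, every dimension)

Crux item stmt-ResolutionOfSingularities-8899 `LocalWeightedDrop`; sub-line TOT2-LINE v1/v1.1 (`L/res-L1-w43-lead-1/g4/TOT2-LINE.md`) §4 (N2).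
[OURS · L1 W4.3, chain w43, res-L1-w43-stub-3 (gen 4) = S-NEAR hand (plan-1 DEALS gen 10 #9; lead-1 v1.1 «S-NEAR (N2) (M, e non-increase at near
points over k̄)»).  MODEL: Cossart–Jannsen–Saito, LNM 2270 (2020) Thm 2.10 (4) (Hironaka [H2] Thm (1,A): `e_{x′}(X′) ≤ e_x(X) − δ_{x′/x}` at near
points; corpus p0035) for a HYPERSURFACE germ and a closed point of the exceptional divisor (δ = 0) — elementary here, on top of part 1's (N1).
Nothing here is a statement of H. Hironaka's manuscript; AI-written, gate-accepted means sorry-free with standard axioms, not refereed.  Def-free.]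

VOCABULARY (as in part 1 and in the engine's binders `hone`/`hcol`/`hcyl`): the degree-`o` form of `f` is the function
`v ↦ CobordantChart.initEval 1 v o f`; an INVARIANCE VECTOR of it is `u` with `∀ v, in_o f (v + u) = in_o f (v)` (these form the directrix
`Dir`, `e = dim Dir`); the point move at `c` with live slot `i₀`, `f(s(c+y)) = s^o·G`, new position read on `G′ := G|_{y_{i₀}=0}` in the letters
`(s, y_j : j ≠ i₀)`; NEAR = `o ≤ ord G′`.
* `inv_add`, `inv_smul`, `inv_sub` — invariance vectors form a subspace.
* **`initEval_slice_cons_zero`** — THE RESTRICTION IDENTITY: the degree-`o` form of `G′` on the exceptional hyperplane `{s = 0}` is the degree-`o`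
  form of `f` on the slice plane `{v_{i₀} = 0}`: `in_o G′ (0, v′) = in_o f (v′ with 0 inserted at i₀)` (top Taylor coefficients = coefficients,
  part 1's `taylorSum_of_degree_eq`; no nearness needed).
* **`insertNth_inv_of_inv_cons_zero`** — at a NEAR point, an invariance vector `(0, u′)` of `in_o G′` inside `{s = 0}` gives the invariance vector
  `u′♮ = (u′ with 0 at i₀)` of `in_o f` (restriction identity on the slice plane, then (N1)'s `c`-invariance to leave the plane).
* **`apexLine_of_near`** — (N2), threshold `e ≤ 1`: if every two invariance vectors of `in_o f` are dependent, then every two invariance vectors of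
  `in_o G′` are dependent — `e_{x′} ≤ e_x` in the only case the surface strategy distinguishes (`e ∈ {1, 2}`; `e = 0` has no near point by
  part 1's (E0), `e = 3` does not occur for a non-constant form in three letters); **`apexTrivial_of_near_of_apexLine'`**-type corollary:
  with `e_x ≤ 1` the successor's invariance vectors are all multiples of ONE vector.
Sequel: (N3) curve centres `w = (1,1,0)`; the `O`-decorated forms are these statements applied to `f̃ = f · ∏_{h ∈ O} h` (lead-1's I₃-device, v1.1 (B)).
-/

set_option linter.dupNamespace false -- mandated namespace of this single-conjunct summit
set_option autoImplicit false

namespace Summit.ResolutionOfSingularities.ResolutionOfSingularities.Theorems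

namespace TOT2Near

open MvPowerSeries Literature.AlgebraicGeometry.Resolution

variable {k : Type} [Field k] {n : ℕ}

/-! ## §1 Invariance vectors form a subspace -/

/-- Sums of invariance vectors are invariance vectors. -/
theorem inv_add {o : ℕ} {g : MvPowerSeries (Fin n) k} {u₁ u₂ : Fin n → k}
    (h₁ : ∀ v, CobordantChart.initEval (fun _ : Fin n => 1) (v + u₁) o g = CobordantChart.initEval (fun _ : Fin n => 1) v o g)
    (h₂ : ∀ v, CobordantChart.initEval (fun _ : Fin n => 1) (v + u₂) o g = CobordantChart.initEval (fun _ : Fin n => 1) v o g)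
    (v : Fin n → k) :
    CobordantChart.initEval (fun _ : Fin n => 1) (v + (u₁ + u₂)) o g = CobordantChart.initEval (fun _ : Fin n => 1) v o g := by
  rw [← add_assoc, h₂, h₁]

/-- Scalar multiples of invariance vectors are invariance vectors (homogeneity; `AxisNormalize.initEval_add_smul`). -/
theorem inv_smul {o : ℕ} {g : MvPowerSeries (Fin n) k} {u : Fin n → k}
    (h : ∀ v, CobordantChart.initEval (fun _ : Fin n => 1) (v + u) o g = CobordantChart.initEval (fun _ : Fin n => 1) v o g)
    (t : k) (v : Fin n → k) :
    CobordantChart.initEval (fun _ : Fin n => 1) (v + t • u) o g = CobordantChart.initEval (fun _ : Fin n => 1) v o g :=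
  AxisNormalize.initEval_add_smul h v t

/-- Linear combinations `a • u₁ - b • u₂` of invariance vectors are invariance vectors. -/
theorem inv_smul_sub_smul {o : ℕ} {g : MvPowerSeries (Fin n) k} {u₁ u₂ : Fin n → k}
    (h₁ : ∀ v, CobordantChart.initEval (fun _ : Fin n => 1) (v + u₁) o g = CobordantChart.initEval (fun _ : Fin n => 1) v o g)
    (h₂ : ∀ v, CobordantChart.initEval (fun _ : Fin n => 1) (v + u₂) o g = CobordantChart.initEval (fun _ : Fin n => 1) v o g)
    (a b : k) (v : Fin n → k) :
    CobordantChart.initEval (fun _ : Fin n => 1) (v + (a • u₁ - b • u₂)) o g = CobordantChart.initEval (fun _ : Fin n => 1) v o g := by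
  rw [sub_eq_add_neg, ← neg_smul]
  exact inv_add (inv_smul h₁ a) (inv_smul h₂ (-b)) v

/-! ## §2 The restriction identity: the successor's form on `{s = 0}` is the form of `f` on the slice plane -/

/-- A vector of the successor's space with vanishing `s`-component is `(0, tail)`. -/
theorem eq_cons_zero_tail {w : Fin (n + 1) → k} (hw : w 0 = 0) : w = Fin.cons (0 : k) (Fin.tail w) := by
  funext l
  refine Fin.cases ?_ (fun j => ?_) l
  · rw [hw, Fin.cons_zero]
  · rw [Fin.cons_succ]; rfl

/-- `(0, v′ + u′) = (0, v′) + (0, u′)`. -/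
theorem cons_zero_add (v' u' : Fin n → k) :
    (Fin.cons (0 : k) (v' + u') : Fin (n + 1) → k) = Fin.cons (0 : k) v' + Fin.cons (0 : k) u' := by
  funext l
  refine Fin.cases ?_ (fun j => ?_) l
  · simp
  · simp

/-- Inserting `0` at `i₀` is additive. -/
theorem insertNth_zero_add {n : ℕ} (i₀ : Fin (n + 1)) (v' u' : Fin n → k) :
    (Fin.insertNth i₀ (0 : k) (v' + u') : Fin (n + 1) → k) = Fin.insertNth i₀ (0 : k) v' + Fin.insertNth i₀ (0 : k) u' := by
  funext l
  refine Fin.succAboveCases i₀ ?_ (fun j => ?_) l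
  · simp
  · simp [Fin.insertNth_apply_succAbove]

/-- A vector of the slice plane `{y_{i₀} = 0}` is the insertion of its restriction. -/
theorem insertNth_restrict {n : ℕ} (i₀ : Fin (n + 1)) {y : Fin (n + 1) → k} (hy : y i₀ = 0) :
    Fin.insertNth i₀ (0 : k) (fun j => y (i₀.succAbove j)) = y := by
  funext l
  refine Fin.succAboveCases i₀ ?_ (fun j => ?_) l
  · rw [Fin.insertNth_apply_same, hy]
  · rw [Fin.insertNth_apply_succAbove]

/-- **THE RESTRICTION IDENTITY** (no nearness needed): for the factorisation `f(s(c + y)) = s^o · G` and the live slot `i₀`, the degree-`o` form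
of the sliced `G′ = G|_{y_{i₀} = 0}` at a point `(0, v′)` of the exceptional hyperplane equals the degree-`o` form of `f` at the point of the slice
plane with coordinates `v′`: `in_o G′ (0, v′) = in_o f (v′ ↑ i₀)`.  (Both are `Σ_{|τ| = o} f_{τ♮} v′^τ`: the `s⁰`-coefficients of `G′` in degree
`o` are the TOP Taylor coefficients `f_{τ♮}` by part 1.) -/
theorem initEval_slice_cons_zero {n : ℕ} (f : MvPowerSeries (Fin (n + 1)) k) (c : Fin (n + 1) → k) (i₀ : Fin (n + 1))
    {o : ℕ} {G : MvPowerSeries (Fin (n + 1 + 1)) k}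
    (hfac : subst (CobordantChart.chart (fun _ : Fin (n + 1) => 1) c) f = X 0 ^ o * G) (v' : Fin n → k) :
    CobordantChart.initEval (fun _ : Fin (n + 1) => 1) (Fin.cons (0 : k) v') o (TupleGame.slice i₀ G) =
      CobordantChart.initEval (fun _ : Fin (n + 1) => 1) (Fin.insertNth i₀ (0 : k) v') o f := by
  classical
  -- the common value: the sum over the exponents `τ` of the slice plane of degree `o`
  set S : k := ∑ τ ∈ (Finset.univ : Finset (Fin n)).finsuppAntidiag o,
      coeff (Finsupp.mapDomain i₀.succAbove τ) f * ∏ j, v' j ^ τ j with hS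
  -- the `s⁰`-coefficients of `G′` in degree `o`
  have hcoeff : ∀ τ : Fin n →₀ ℕ, τ.degree = o →
      coeff (Finsupp.cons 0 τ) (TupleGame.slice i₀ G) = coeff (Finsupp.mapDomain i₀.succAbove τ) f := by
    intro τ hτ
    have hβ0 : Finsupp.mapDomain i₀.succAbove τ i₀ = 0 := CoeffTransport.mapDomain_succAbove_apply_self i₀ τ
    have hres : (Finsupp.equivFunOnFinite.symm fun j => Finsupp.mapDomain i₀.succAbove τ (i₀.succAbove j)) = τ := by
      ext j
      simp [CoeffTransport.mapDomain_succAbove_apply_succAbove]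
    have h := taylorSum_eq_coeff_slice f c i₀ o (Finsupp.mapDomain i₀.succAbove τ) hβ0
    rw [hres, hfac, NCTransport.slice_X_zero_pow_mul', CoeffTransport.coeff_cons_X_pow_mul] at h
    rw [← h, taylorSum_of_degree_eq f c]
    rw [← degree_restrict i₀ _ hβ0, hres, hτ]
  -- LHS = S
  have hL : CobordantChart.initEval (fun _ : Fin (n + 1) => 1) (Fin.cons (0 : k) v') o (TupleGame.slice i₀ G) = S := by
    rw [ApexFreeOrderDrop.initEval_one_eq_sum]
    -- kill the exponents with positive `s`-degree
    rw [← Finset.sum_filter_add_sum_filter_not _ (fun E : Fin (n + 1) →₀ ℕ => E 0 = 0)]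
    rw [Finset.sum_eq_zero (s := ((Finset.univ : Finset (Fin (n + 1))).finsuppAntidiag o).filter fun E => ¬ E 0 = 0)
      (fun E hE => by
        rw [Finset.mem_filter] at hE
        rw [Fin.prod_univ_succ, Fin.cons_zero, zero_pow hE.2, zero_mul, mul_zero]), add_zero]
    -- reindex the exponents `(0, τ)` by `τ`
    rw [hS]
    refine Finset.sum_bij' (fun E _ => Finsupp.tail E) (fun τ _ => Finsupp.cons 0 τ) ?_ ?_ ?_ ?_ ?_
    · intro E hE
      rw [Finset.mem_filter] at hE
      have hE' : E ∈ (Finset.univ : Finset (Fin (n + 1))).finsuppAntidiag o := hE.1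
      rw [ApexFreeOrderDrop.mem_antidiag_iff, ApexFreeOrderDrop.weight_one_eq_degree] at hE' ⊢
      rw [← hE', ← Finsupp.cons_tail E, hE.2, CoeffTransport.degree_cons_zero, Finsupp.tail_cons]
    · intro τ hτ
      rw [Finset.mem_filter, Finsupp.cons_zero]
      refine ⟨?_, rfl⟩
      rw [ApexFreeOrderDrop.mem_antidiag_iff, ApexFreeOrderDrop.weight_one_eq_degree] at hτ ⊢
      rw [CoeffTransport.degree_cons_zero, hτ]
    · intro E hE
      rw [Finset.mem_filter] at hE
      conv_rhs => rw [← Finsupp.cons_tail E]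
      rw [hE.2]
    · intro τ _
      exact Finsupp.tail_cons 0 τ
    · intro E hE
      rw [Finset.mem_filter] at hE
      have hE0 : E = Finsupp.cons 0 (Finsupp.tail E) := by
        conv_lhs => rw [← Finsupp.cons_tail E]
        rw [hE.2]
      have hdeg : (Finsupp.tail E).degree = o := by
        have h1 : E ∈ (Finset.univ : Finset (Fin (n + 1))).finsuppAntidiag o := hE.1
        rw [ApexFreeOrderDrop.mem_antidiag_iff, ApexFreeOrderDrop.weight_one_eq_degree, hE0, CoeffTransport.degree_cons_zero] at h1
        exact h1
      rw [hE0, hcoeff _ hdeg, Finsupp.tail_cons, Fin.prod_univ_succ, Finsupp.cons_zero, pow_zero, one_mul]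
      simp only [Fin.cons_succ, Finsupp.cons_succ]
  -- RHS = S
  have hR : CobordantChart.initEval (fun _ : Fin (n + 1) => 1) (Fin.insertNth i₀ (0 : k) v') o f = S := by
    rw [ApexFreeOrderDrop.initEval_one_eq_sum]
    rw [← Finset.sum_filter_add_sum_filter_not _ (fun e : Fin (n + 1) →₀ ℕ => e i₀ = 0)]
    rw [Finset.sum_eq_zero (s := ((Finset.univ : Finset (Fin (n + 1))).finsuppAntidiag o).filter fun e => ¬ e i₀ = 0)
      (fun e he => by
        rw [Finset.mem_filter] at he
        rw [Fin.prod_univ_succAbove _ i₀, Fin.insertNth_apply_same, zero_pow he.2, zero_mul, mul_zero]), add_zero]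
    rw [hS]
    refine Finset.sum_bij' (fun e _ => Finsupp.equivFunOnFinite.symm fun j => e (i₀.succAbove j))
      (fun τ _ => Finsupp.mapDomain i₀.succAbove τ) ?_ ?_ ?_ ?_ ?_
    · intro e he
      rw [Finset.mem_filter] at he
      have he' : e ∈ (Finset.univ : Finset (Fin (n + 1))).finsuppAntidiag o := he.1
      rw [ApexFreeOrderDrop.mem_antidiag_iff, ApexFreeOrderDrop.weight_one_eq_degree] at he' ⊢
      rw [degree_restrict i₀ e he.2, he']
    · intro τ hτ
      rw [Finset.mem_filter]
      refine ⟨?_, CoeffTransport.mapDomain_succAbove_apply_self i₀ τ⟩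
      rw [ApexFreeOrderDrop.mem_antidiag_iff, ApexFreeOrderDrop.weight_one_eq_degree] at hτ ⊢
      rw [← degree_restrict i₀ _ (CoeffTransport.mapDomain_succAbove_apply_self i₀ τ)]
      have hres : (Finsupp.equivFunOnFinite.symm fun j => Finsupp.mapDomain i₀.succAbove τ (i₀.succAbove j)) = τ := by
        ext j
        simp [CoeffTransport.mapDomain_succAbove_apply_succAbove]
      rw [hres, hτ]
    · intro e he
      rw [Finset.mem_filter] at he
      exact mapDomain_succAbove_restrict i₀ e he.2
    · intro τ _
      ext j
      simp [CoeffTransport.mapDomain_succAbove_apply_succAbove]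
    · intro e he
      rw [Finset.mem_filter] at he
      rw [mapDomain_succAbove_restrict i₀ e he.2, Fin.prod_univ_succAbove _ i₀, Fin.insertNth_apply_same, he.2, pow_zero, one_mul]
      simp only [Fin.insertNth_apply_succAbove, Finsupp.coe_equivFunOnFinite_symm]
  rw [hL, hR]

/-! ## §3 (N2): at a near point the directrix does not grow -/

/-- **AT A NEAR POINT, `(0, u′) ∈ Dir(in_o G′) ⇒ u′♮ ∈ Dir(in_o f)`**: under the point move at `c` (live slot `i₀`, `c_{i₀} ≠ 0`,
`f(s(c + y)) = s^o · G`) with NEAR successor (`o ≤ ord G′`), a translation-invariance vector of the successor's degree-`o` form lying in the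
exceptional hyperplane, `(0, u′)`, yields the translation-invariance vector `u′♮ = (u′ with 0 inserted at i₀)` of the degree-`o` form of `f`:
on the slice plane by the restriction identity, off it by (N1) (`c` is an invariance vector, part 1). -/
theorem insertNth_inv_of_inv_cons_zero {n : ℕ} (f : MvPowerSeries (Fin (n + 1)) k) (c : Fin (n + 1) → k) (i₀ : Fin (n + 1))
    (hc : c i₀ ≠ 0) {o : ℕ} {G : MvPowerSeries (Fin (n + 1 + 1)) k}
    (hfac : subst (CobordantChart.chart (fun _ : Fin (n + 1) => 1) c) f = X 0 ^ o * G)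
    (hnear : (o : ℕ∞) ≤ (TupleGame.slice i₀ G).order) {u' : Fin n → k}
    (hu : ∀ w, CobordantChart.initEval (fun _ : Fin (n + 1) => 1) (w + Fin.cons (0 : k) u') o (TupleGame.slice i₀ G) =
      CobordantChart.initEval (fun _ : Fin (n + 1) => 1) w o (TupleGame.slice i₀ G))
    (v : Fin (n + 1) → k) :
    CobordantChart.initEval (fun _ : Fin (n + 1) => 1) (v + Fin.insertNth i₀ (0 : k) u') o f =
      CobordantChart.initEval (fun _ : Fin (n + 1) => 1) v o f := by
  -- on the slice plane: the restriction identity, twice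
  have hplane : ∀ v' : Fin n → k,
      CobordantChart.initEval (fun _ : Fin (n + 1) => 1) (Fin.insertNth i₀ (0 : k) v' + Fin.insertNth i₀ (0 : k) u') o f =
        CobordantChart.initEval (fun _ : Fin (n + 1) => 1) (Fin.insertNth i₀ (0 : k) v') o f := by
    intro v'
    rw [← insertNth_zero_add, ← initEval_slice_cons_zero f c i₀ hfac, ← initEval_slice_cons_zero f c i₀ hfac, cons_zero_add, hu]
  -- off the plane: move along `c`, an invariance vector by (N1)
  have hy : (v - (v i₀ / c i₀) • c) i₀ = 0 := by
    show v i₀ - (v i₀ / c i₀) * c i₀ = 0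
    rw [div_mul_cancel₀ _ hc, sub_self]
  have hv : v = Fin.insertNth i₀ (0 : k) (fun j => (v - (v i₀ / c i₀) • c) (i₀.succAbove j)) + (v i₀ / c i₀) • c := by
    rw [insertNth_restrict i₀ hy, sub_add_cancel]
  rw [hv, add_right_comm, initEval_add_smul_eq_of_near f c i₀ hc hfac hnear, initEval_add_smul_eq_of_near f c i₀ hc hfac hnear,
    hplane]

/-- **… HENCE, IF `e_x ≤ 1`, THE SUCCESSOR HAS NO NON-ZERO INVARIANCE VECTOR INSIDE `{s = 0}`**: if every two invariance vectors of the
degree-`o` form of `f` are linearly dependent (`dim Dir ≤ 1`; then `Dir = k·c` at a near point, by (N1)), an invariance vector `(0, u′)` of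
the successor's form has `u′ = 0` — since `u′♮` and `c` are dependent and `c_{i₀} ≠ 0 = (u′♮)_{i₀}`. -/
theorem eq_zero_of_inv_cons_zero {n : ℕ} (f : MvPowerSeries (Fin (n + 1)) k) (c : Fin (n + 1) → k) (i₀ : Fin (n + 1))
    (hc : c i₀ ≠ 0) {o : ℕ} {G : MvPowerSeries (Fin (n + 1 + 1)) k}
    (hfac : subst (CobordantChart.chart (fun _ : Fin (n + 1) => 1) c) f = X 0 ^ o * G)
    (hnear : (o : ℕ∞) ≤ (TupleGame.slice i₀ G).order)
    (hone : ∀ u₁ u₂ : Fin (n + 1) → k,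
      (∀ v, CobordantChart.initEval (fun _ : Fin (n + 1) => 1) (v + u₁) o f = CobordantChart.initEval (fun _ : Fin (n + 1) => 1) v o f) →
      (∀ v, CobordantChart.initEval (fun _ : Fin (n + 1) => 1) (v + u₂) o f = CobordantChart.initEval (fun _ : Fin (n + 1) => 1) v o f) →
      ∃ α β : k, (α ≠ 0 ∨ β ≠ 0) ∧ α • u₁ + β • u₂ = 0)
    {u' : Fin n → k}
    (hu : ∀ w, CobordantChart.initEval (fun _ : Fin (n + 1) => 1) (w + Fin.cons (0 : k) u') o (TupleGame.slice i₀ G) =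
      CobordantChart.initEval (fun _ : Fin (n + 1) => 1) w o (TupleGame.slice i₀ G)) :
    u' = 0 := by
  obtain ⟨α, β, hαβ, hrel⟩ := hone _ c (insertNth_inv_of_inv_cons_zero f c i₀ hc hfac hnear hu) fun v => by
    have h := initEval_add_smul_eq_of_near f c i₀ hc hfac hnear 1 v
    rwa [one_smul] at h
  have hi₀ := congr_fun hrel i₀
  simp only [Pi.add_apply, Pi.smul_apply, Fin.insertNth_apply_same, smul_eq_mul, mul_zero, zero_add, Pi.zero_apply] at hi₀
  have hβ : β = 0 := (mul_eq_zero.mp hi₀).resolve_right hc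
  have hα : α ≠ 0 := hαβ.resolve_right fun h => h hβ
  funext j
  have hj := congr_fun hrel (i₀.succAbove j)
  simp only [Pi.add_apply, Pi.smul_apply, Fin.insertNth_apply_succAbove, hβ, zero_smul, add_zero, smul_eq_mul, Pi.zero_apply] at hj
  exact (mul_eq_zero.mp hj).resolve_left hα

/-- `(0, 0) = 0`. -/
theorem cons_zero_zero : (Fin.cons (0 : k) (0 : Fin n → k) : Fin (n + 1) → k) = 0 := by
  funext l
  refine Fin.cases ?_ (fun j => ?_) l
  · simp
  · simp

/-- **(N2) THE DIRECTRIX DOES NOT GROW AT A NEAR POINT** (Cossart–Jannsen–Saito Thm 2.10 (4) = Hironaka's `e_{x′} ≤ e_x`, hypersurface form,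
threshold `e_x ≤ 1`, every characteristic, every dimension): under the point move at the exceptional point `c` (live slot `i₀`,
`f(s(c + y)) = s^o · G`) with NEAR successor `G′ = G|_{y_{i₀} = 0}` (`o ≤ ord G′`): if every two translation-invariance vectors of the degree-`o`
form of `f` are linearly dependent, then so are every two translation-invariance vectors of the degree-`o` form of `G′`.
(The combination of two successor vectors with vanishing `s`-component is `(0, u′)` with `u′ = 0` by `eq_zero_of_inv_cons_zero`; if both are
already `s`-free, the first one is itself `0`.)  This is the binder `hone` of the engine skeleton propagated to the successor of a near move.
[cite: CossartJannsenSaito2020, Thm 2.10 (4) (LNM 2270; corpus p0035)] -/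
theorem apexLine_of_near {n : ℕ} (f : MvPowerSeries (Fin (n + 1)) k) (c : Fin (n + 1) → k) (i₀ : Fin (n + 1))
    (hc : c i₀ ≠ 0) {o : ℕ} {G : MvPowerSeries (Fin (n + 1 + 1)) k}
    (hfac : subst (CobordantChart.chart (fun _ : Fin (n + 1) => 1) c) f = X 0 ^ o * G)
    (hnear : (o : ℕ∞) ≤ (TupleGame.slice i₀ G).order)
    (hone : ∀ u₁ u₂ : Fin (n + 1) → k,
      (∀ v, CobordantChart.initEval (fun _ : Fin (n + 1) => 1) (v + u₁) o f = CobordantChart.initEval (fun _ : Fin (n + 1) => 1) v o f) →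
      (∀ v, CobordantChart.initEval (fun _ : Fin (n + 1) => 1) (v + u₂) o f = CobordantChart.initEval (fun _ : Fin (n + 1) => 1) v o f) →
      ∃ α β : k, (α ≠ 0 ∨ β ≠ 0) ∧ α • u₁ + β • u₂ = 0)
    (w₁ w₂ : Fin (n + 1) → k)
    (hw₁ : ∀ w, CobordantChart.initEval (fun _ : Fin (n + 1) => 1) (w + w₁) o (TupleGame.slice i₀ G) =
      CobordantChart.initEval (fun _ : Fin (n + 1) => 1) w o (TupleGame.slice i₀ G))
    (hw₂ : ∀ w, CobordantChart.initEval (fun _ : Fin (n + 1) => 1) (w + w₂) o (TupleGame.slice i₀ G) =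
      CobordantChart.initEval (fun _ : Fin (n + 1) => 1) w o (TupleGame.slice i₀ G)) :
    ∃ α β : k, (α ≠ 0 ∨ β ≠ 0) ∧ α • w₁ + β • w₂ = 0 := by
  -- the combination with vanishing `s`-component vanishes
  have hcomb : w₂ 0 • w₁ - w₁ 0 • w₂ = 0 := by
    have h0 : (w₂ 0 • w₁ - w₁ 0 • w₂) 0 = 0 := by
      show w₂ 0 * w₁ 0 - w₁ 0 * w₂ 0 = 0
      ring
    have hinv : ∀ w, CobordantChart.initEval (fun _ : Fin (n + 1) => 1) (w + (w₂ 0 • w₁ - w₁ 0 • w₂)) o (TupleGame.slice i₀ G) =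
        CobordantChart.initEval (fun _ : Fin (n + 1) => 1) w o (TupleGame.slice i₀ G) :=
      inv_smul_sub_smul hw₁ hw₂ (w₂ 0) (w₁ 0)
    rw [eq_cons_zero_tail h0] at hinv ⊢
    rw [eq_zero_of_inv_cons_zero f c i₀ hc hfac hnear hone hinv, cons_zero_zero]
  by_cases h : w₁ 0 = 0 ∧ w₂ 0 = 0
  · -- both `s`-free: the first vector is itself `0`
    have hw₁0 : w₁ = 0 := by
      have hinv := hw₁
      rw [eq_cons_zero_tail h.1] at hinv ⊢
      rw [eq_zero_of_inv_cons_zero f c i₀ hc hfac hnear hone hinv, cons_zero_zero]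
    exact ⟨1, 0, Or.inl one_ne_zero, by rw [hw₁0, smul_zero, zero_smul, add_zero]⟩
  · refine ⟨w₂ 0, -w₁ 0, ?_, by rw [neg_smul, ← sub_eq_add_neg, hcomb]⟩
    rw [not_and_or] at h
    rcases h with h | h
    · exact Or.inr (neg_ne_zero.mpr h)
    · exact Or.inl h

/-- **(N2), `e_x = 1` read-out**: with `dim Dir(in_o f) ≤ 1`, every invariance vector of the successor's degree-`o` form at a near point is a
multiple of any one with non-zero `s`-component — in particular an `s`-FREE invariance vector of the successor is `0` (the new directrix, if
a line, is transverse to the exceptional hyperplane `{s = 0}`). -/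
theorem inv_eq_zero_of_near_of_apply_zero {n : ℕ} (f : MvPowerSeries (Fin (n + 1)) k) (c : Fin (n + 1) → k) (i₀ : Fin (n + 1))
    (hc : c i₀ ≠ 0) {o : ℕ} {G : MvPowerSeries (Fin (n + 1 + 1)) k}
    (hfac : subst (CobordantChart.chart (fun _ : Fin (n + 1) => 1) c) f = X 0 ^ o * G)
    (hnear : (o : ℕ∞) ≤ (TupleGame.slice i₀ G).order)
    (hone : ∀ u₁ u₂ : Fin (n + 1) → k,
      (∀ v, CobordantChart.initEval (fun _ : Fin (n + 1) => 1) (v + u₁) o f = CobordantChart.initEval (fun _ : Fin (n + 1) => 1) v o f) →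
      (∀ v, CobordantChart.initEval (fun _ : Fin (n + 1) => 1) (v + u₂) o f = CobordantChart.initEval (fun _ : Fin (n + 1) => 1) v o f) →
      ∃ α β : k, (α ≠ 0 ∨ β ≠ 0) ∧ α • u₁ + β • u₂ = 0)
    {w₁ : Fin (n + 1) → k}
    (hw₁ : ∀ w, CobordantChart.initEval (fun _ : Fin (n + 1) => 1) (w + w₁) o (TupleGame.slice i₀ G) =
      CobordantChart.initEval (fun _ : Fin (n + 1) => 1) w o (TupleGame.slice i₀ G))
    (h0 : w₁ 0 = 0) : w₁ = 0 := by
  have hinv := hw₁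
  rw [eq_cons_zero_tail h0] at hinv ⊢
  rw [eq_zero_of_inv_cons_zero f c i₀ hc hfac hnear hone hinv, cons_zero_zero]

end TOT2Near

end Summit.ResolutionOfSingularities.ResolutionOfSingularities.Theorems
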